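import Summits.BirchSwinnertonDyer.Rank1Residual.WAll.TargetPrimeSlices
import HarnessLib
import HarnessLib.Audit.Tags

/-!
# Rung W-ALL of ladder BSD (D-0120) — row 2 at `p ≥ 5`, rank one: the ♯ SLICE of route
# `AdditiveKolyvaginRoad` (onto image ∧ ♠ ∧ two Steinberg primes ∧ `p ∤ ∏ c_ℓ`), its complement (the
# route's residual item, verbatim), and the ♯ slice by LOCAL TYPE at `p` (abelian / non-abelian, the
# route's rev-6 split) (cell `bsd-wall`, lane (2), seat `bsd-wall-ty-1`; new small file importing
# `WAll.TargetPrimeSlices` only)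

HONEST FRAMING (cell `bsd-wall`, run/shared/lean/pub/bsd-wall/; brief `WALL-BRIEF-v1.md` sha16
b966bf16da27706e §2): STATEMENTS AND BOOKKEEPING ONLY — nothing asserted, nothing booked, no named
fact, no published theorem restated; the four `@[conjecture] def`s below are OPEN obligations and
SLICES of the registered slice leaf `WAllExclAdditiveFiveLeRankOne` (`TargetPrimeSlices.lean` §1: non-CM,
`5 ≤ p` additive, `r = 1` ⇒ `BSD(E,p)`), hence of row 2 `WAllExclAdditive` of `WAll/Target.lean`.

WHY THESE SLICES. The lane-3 route `route-BirchSwinnertonDyer-AdditiveKolyvaginRoad` (OPEN, rev 6;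
`--closes-target Summit.BirchSwinnertonDyer.WAllExclAdditive`, the whole row) attacks exactly ONE
sub-cell of row 2 — the ♯ LOCUS at `p ≥ 5`, rank one: `ρ̄_{E,p}` onto, ♠ (`p ∤ ord_ℓ Δ_min` at every
multiplicative `ℓ`), at least two multiplicative primes, `p ∤ ∏ c_ℓ` (the conclusion of its kernel item
`AdditiveKolyvaginKernel`, stmt-BirchSwinnertonDyer-20138) — and carries the rest of the row as THREE
residual route items: `RankZeroAdditive` (20133) = the registered slice `WAllExclAdditiveFiveLeRankZero`
VERBATIM, `AdditiveAtThree` (20135) = the registered slice `WAllExclAdditiveAtThree` VERBATIM, and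
`OffSharpRankOneAdditive` (20134) = «`p ≥ 5`, `r = 1`, NOT ♯» — the one residual that is NOT yet a
W-ALL leaf by name. This file adds the ♯ / off-♯ cut of `WAllExclAdditiveFiveLeRankOne` VERBATIM in the
route's spelling, so that (i) the route may `--closes-target` the ♯ leaf BY NAME with no residual item of
its own (its deciding theorem is then `hK hP hM h₁ h₀` on the nose: the kernel's conclusion IS
`WAllExclAdditiveFiveLeRankOneSharp`), (ii) item 20134 is a registered-shape leaf
(`WAllExclAdditiveFiveLeRankOneOffSharp`, so a prover closes either from the other by `exact`), and
(iii) the ♯ leaf is cut once more along the route's rev-6 TYPE SPLIT of its crux (stmt 20132 →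
20418 abelian type `SubM ∨ SubGord` / 20419 non-abelian type `SubTprime ∨ SubW`, glue 20420 by
`Rank1Residual.Additive.sub_exhaustive`), so a proof of one child closes a named W-ALL atom.
Instrument reading (planner `bsd-wall-add` g0, HOME `bsd-wall-add/census_sharp.md`, N < 5·10⁵, the two
counted tables (M) r1 and X4R1 (G-ord, `e = 2`)): `p ≥ 5`, `r = 1`: `552` (class, p) keys → ♯ `119`
(`21.6 %`; (M) `71`, all X4, + (G-ord, e = 2) `48`), off-♯ `433` (`173` not onto · `255` `p ∣ ord_ℓ Δ` ·
`5` with fewer than two multiplicative primes); (G-ord) `e ∈ {3,4,6}` r1 and potentially supersingular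
`p ≥ 5` cells: count owed.

| slice `Prop` (this file) | shape (all `∀ W [..] [..] (p) [Fact p.Prime], ¬ W.HasCM → 5 ≤ p → Addv W p → …`) | keys of record |
|---|---|---|
| `WAllExclAdditiveFiveLeRankOneSharp` | `… → r = 1 → onto → ♠ → (∃ ℓ₁ ≠ ℓ₂ multiplicative) → ¬ p ∣ ∏ c_ℓ → BSDp W p` (= the kernel's conclusion VERBATIM) | `119` + uncounted cells |
| `WAllExclAdditiveFiveLeRankOneOffSharp` | `… → r = 1 → ¬ (onto ∧ ♠ ∧ two ∧ ¬ p ∣ ∏ c_ℓ) → BSDp W p` (= item 20134 VERBATIM) | `433` + uncounted cells |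
| `WAllExclAdditiveFiveLeRankOneSharpAbelianType` | `… → (SubM ∨ SubGord) → r = 1 → onto → ♠ → two → ¬ p ∣ ∏ c_ℓ → BSDp W p` | all `119` counted keys |
| `WAllExclAdditiveFiveLeRankOneSharpNonAbelianType` | `… → (SubTprime ∨ SubW) → …` (supercuspidal type; `SubW` vacuous at `p ≥ 5`) | count owed |

* §1 the four slice `Prop`s;
* §2 glue (no mathematics; excluded middle and `sub_exhaustive` only): `wAllExclAdditiveFiveLeRankOne_iff_sharp_offSharp`
  (EXACT — the route's `closes` case split), `wAllExclAdditiveFiveLeRankOneSharp_iff_types` (EXACT),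
  each ⇐ the rank-one slice ⇐ `WAll`;
* §3 registry keys: `WAllExclAdditiveFiveLe` ⇐ rank-`0` slice ∧ ♯ ∧ off-♯; row 2 ⇐ the slice at `3`
  ∧ rank-`0` at `p ≥ 5` ∧ ♯ ∧ off-♯ (the AKR assembly read through leaves; feed to
  `Rank1Residual.WAll.wAll_of_slicedLeaves_primaryGZ` / `wallExclAdditive_of_atThree_of_fiveLeLeaves`).

References: `WAll/TargetPrimeSlices.lean`, `WAll/TargetAdditive.lean`, `WAll/Target.lean`;
`Rank1Residual/Additive/SharpenedStatements.lean` (`SubM`, `SubGord`, `SubTprime`, `SubW`, `sub_exhaustive`);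
route file `Summits/BirchSwinnertonDyer/BirchSwinnertonDyer/Theses/AdditiveKolyvaginRoad.lean` rev 6 (items
20133 / 20134 / 20135 / 20138 / 20418 / 20419, `closes`); HOME `bsd-wall-add/census_sharp.md`,
`bsd-wall-add/g3/SplitByType.lean`; [cite: Miller2011LMS, §1 and Def. 1.1] (the currency `BSD(E,p)`);
[cite: WZhang2014, Thm. 1.1] (the hypotheses ♠ / onto / `p ∤ ∏ c_ℓ` being sliced along, as printed for
the semistable case).
-/

noncomputable section

open scoped Classical

open WeierstrassCurve Literature.NumberTheory.EllipticCurves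
  Literature.NumberTheory.EllipticCurves.Rank1Residual Literature.NumberTheory.EllipticCurves.ModularForms
open Summit.BirchSwinnertonDyer.Rank1Residual

set_option autoImplicit false

namespace Summit.BirchSwinnertonDyer

/-! ### §1. Row 2 at `p ≥ 5`, rank one: ♯ / off-♯, and ♯ by local type -/

/-- **Row 2 at `p ≥ 5`, rank one, ON THE ♯ LOCUS (OPEN)**: non-CM, `5 ≤ p` additive, `r = 1`,
`ρ̄_{E,p}` onto, ♠ (`p ∤ ord_ℓ(Δ_min)` at every multiplicative prime `ℓ`), at least two multiplicative
primes, `p ∤ ∏ c_ℓ` ⇒ `BSD(E,p)` — the attacked cell of route `AdditiveKolyvaginRoad`, spelled as the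
conclusion of its kernel item `AdditiveKolyvaginKernel` VERBATIM (`119` of the `552` counted `p ≥ 5`
rank-one keys, N < 5·10⁵, + the uncounted cells). [folklore] -/
@[conjecture] def WAllExclAdditiveFiveLeRankOneSharp : Prop :=
  ∀ (W : WeierstrassCurve ℚ) [W.IsElliptic] [W.IsGloballyMinimal] (p : ℕ) [Fact p.Prime],
    ¬ W.HasCM → 5 ≤ p → Addv W p → W.analyticRank = 1 → W.HasSurjectiveModNGaloisRep p →
      (∀ (ℓ : ℕ) [Fact ℓ.Prime], W.HasMultiplicativeReductionAtPrime ℓ →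
        ¬ p ∣ padicValInt ℓ W.minimalDiscriminantInt) →
      (∃ (ℓ₁ ℓ₂ : ℕ) (_ : Fact ℓ₁.Prime) (_ : Fact ℓ₂.Prime), ℓ₁ ≠ ℓ₂ ∧
        W.HasMultiplicativeReductionAtPrime ℓ₁ ∧ W.HasMultiplicativeReductionAtPrime ℓ₂) →
      ¬ p ∣ W.tamagawaProduct → BSDp W p

/-- **Row 2 at `p ≥ 5`, rank one, OFF THE ♯ LOCUS (OPEN)** — the statement of route item
`OffSharpRankOneAdditive` (stmt-BirchSwinnertonDyer-20134) VERBATIM: non-CM, `5 ≤ p` additive, `r = 1`,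
and NOT (onto ∧ ♠ ∧ two multiplicative primes ∧ `p ∤ ∏ c_ℓ`) ⇒ `BSD(E,p)` (`433` counted keys: `173`
not onto · `255` with `p ∣ ord_ℓ Δ` · `5` with fewer than two multiplicative primes; the rows no
Heegner-point Kolyvagin argument in print reaches — Jetchev 2008: `p ∣ c_ℓ` forces extra divisibility
of `y_K`). [folklore] -/
@[conjecture] def WAllExclAdditiveFiveLeRankOneOffSharp : Prop :=
  ∀ (W : WeierstrassCurve ℚ) [W.IsElliptic] [W.IsGloballyMinimal] (p : ℕ) [Fact p.Prime],
    ¬ W.HasCM → 5 ≤ p → Addv W p → W.analyticRank = 1 →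
      ¬ (W.HasSurjectiveModNGaloisRep p ∧
          (∀ (ℓ : ℕ) [Fact ℓ.Prime], W.HasMultiplicativeReductionAtPrime ℓ →
            ¬ p ∣ padicValInt ℓ W.minimalDiscriminantInt) ∧
          (∃ (ℓ₁ ℓ₂ : ℕ) (_ : Fact ℓ₁.Prime) (_ : Fact ℓ₂.Prime), ℓ₁ ≠ ℓ₂ ∧
            W.HasMultiplicativeReductionAtPrime ℓ₁ ∧ W.HasMultiplicativeReductionAtPrime ℓ₂) ∧
          ¬ p ∣ W.tamagawaProduct) → BSDp W p

/-- **The ♯ locus of ABELIAN local type at `p` (OPEN)**: the ♯ slice restricted to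
`Additive.SubM W p ∨ Additive.SubGord W p` (potentially multiplicative, or potentially good with
`e ∣ p − 1`; all `119` counted ♯ keys lie here) — the habitat of the route's rev-6 child crux
`KolyvaginPrimitiveAdditiveAbelianType` (stmt-BirchSwinnertonDyer-20418; the type hypothesis is placed
right after `Addv W p`, as there). [folklore] -/
@[conjecture] def WAllExclAdditiveFiveLeRankOneSharpAbelianType : Prop :=
  ∀ (W : WeierstrassCurve ℚ) [W.IsElliptic] [W.IsGloballyMinimal] (p : ℕ) [Fact p.Prime],
    ¬ W.HasCM → 5 ≤ p → Addv W p → (Additive.SubM W p ∨ Additive.SubGord W p) →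
      W.analyticRank = 1 → W.HasSurjectiveModNGaloisRep p →
      (∀ (ℓ : ℕ) [Fact ℓ.Prime], W.HasMultiplicativeReductionAtPrime ℓ →
        ¬ p ∣ padicValInt ℓ W.minimalDiscriminantInt) →
      (∃ (ℓ₁ ℓ₂ : ℕ) (_ : Fact ℓ₁.Prime) (_ : Fact ℓ₂.Prime), ℓ₁ ≠ ℓ₂ ∧
        W.HasMultiplicativeReductionAtPrime ℓ₁ ∧ W.HasMultiplicativeReductionAtPrime ℓ₂) →
      ¬ p ∣ W.tamagawaProduct → BSDp W p

/-- **The ♯ locus of NON-ABELIAN local type at `p` (OPEN)**: the ♯ slice restricted to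
`Additive.SubTprime W p ∨ Additive.SubW W p` (potentially good with `e ∤ p − 1`, supercuspidal type;
`SubW` is vacuous for `p ≥ 5` but kept formal, as in the route) — the habitat of the rev-6 child crux
`KolyvaginPrimitiveAdditiveNonAbelianType` (stmt-BirchSwinnertonDyer-20419; count owed). [folklore] -/
@[conjecture] def WAllExclAdditiveFiveLeRankOneSharpNonAbelianType : Prop :=
  ∀ (W : WeierstrassCurve ℚ) [W.IsElliptic] [W.IsGloballyMinimal] (p : ℕ) [Fact p.Prime],
    ¬ W.HasCM → 5 ≤ p → Addv W p → (Additive.SubTprime W p ∨ Additive.SubW W p) →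
      W.analyticRank = 1 → W.HasSurjectiveModNGaloisRep p →
      (∀ (ℓ : ℕ) [Fact ℓ.Prime], W.HasMultiplicativeReductionAtPrime ℓ →
        ¬ p ∣ padicValInt ℓ W.minimalDiscriminantInt) →
      (∃ (ℓ₁ ℓ₂ : ℕ) (_ : Fact ℓ₁.Prime) (_ : Fact ℓ₂.Prime), ℓ₁ ≠ ℓ₂ ∧
        W.HasMultiplicativeReductionAtPrime ℓ₁ ∧ W.HasMultiplicativeReductionAtPrime ℓ₂) →
      ¬ p ∣ W.tamagawaProduct → BSDp W p

/-! ### §2. Glue (excluded middle and `sub_exhaustive` only) -/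

/-- **Rank one at `p ≥ 5` ⟺ ♯ ∧ off-♯** (excluded middle on the ♯ conjunction; EXACT) — the case split
of the route's deciding theorem `closes`, now between two named leaves. [folklore] -/
theorem wAllExclAdditiveFiveLeRankOne_iff_sharp_offSharp :
    WAllExclAdditiveFiveLeRankOne ↔
      WAllExclAdditiveFiveLeRankOneSharp ∧ WAllExclAdditiveFiveLeRankOneOffSharp :=
  ⟨fun h ↦ ⟨fun W _ _ p _ hcm h5 hadd hr _ _ _ _ ↦ h W p hcm h5 hadd hr,
      fun W _ _ p _ hcm h5 hadd hr _ ↦ h W p hcm h5 hadd hr⟩,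
    fun ⟨hS, hO⟩ W _ _ p _ hcm h5 hadd hr ↦ by
      by_cases hsharp : (W.HasSurjectiveModNGaloisRep p ∧
          (∀ (ℓ : ℕ) [Fact ℓ.Prime], W.HasMultiplicativeReductionAtPrime ℓ →
            ¬ p ∣ padicValInt ℓ W.minimalDiscriminantInt) ∧
          (∃ (ℓ₁ ℓ₂ : ℕ) (_ : Fact ℓ₁.Prime) (_ : Fact ℓ₂.Prime), ℓ₁ ≠ ℓ₂ ∧
            W.HasMultiplicativeReductionAtPrime ℓ₁ ∧ W.HasMultiplicativeReductionAtPrime ℓ₂) ∧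
          ¬ p ∣ W.tamagawaProduct)
      · obtain ⟨hs, hsp, htwo, htam⟩ := hsharp
        exact hS W p hcm h5 hadd hr hs hsp htwo htam
      · exact hO W p hcm h5 hadd hr hsharp⟩

/-- The rank-one slice at `p ≥ 5` from its two ♯-slices. [folklore] -/
theorem wAllExclAdditiveFiveLeRankOne_of_sharp_of_offSharp (hS : WAllExclAdditiveFiveLeRankOneSharp)
    (hO : WAllExclAdditiveFiveLeRankOneOffSharp) : WAllExclAdditiveFiveLeRankOne :=
  wAllExclAdditiveFiveLeRankOne_iff_sharp_offSharp.2 ⟨hS, hO⟩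

/-- Conversely the rank-one slice restricts to both. [folklore] -/
theorem sharpSlices_of_wAllExclAdditiveFiveLeRankOne (h : WAllExclAdditiveFiveLeRankOne) :
    WAllExclAdditiveFiveLeRankOneSharp ∧ WAllExclAdditiveFiveLeRankOneOffSharp :=
  wAllExclAdditiveFiveLeRankOne_iff_sharp_offSharp.1 h

/-- **♯ ⟺ ♯-abelian-type ∧ ♯-non-abelian-type** (EXACT, by the census exhaustion
`SubM ∨ SubGord ∨ SubTprime ∨ SubW`, `Rank1Residual.Additive.sub_exhaustive`) — the rev-6 type split
of the route's crux, read on the leaf. [folklore] -/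
theorem wAllExclAdditiveFiveLeRankOneSharp_iff_types :
    WAllExclAdditiveFiveLeRankOneSharp ↔
      WAllExclAdditiveFiveLeRankOneSharpAbelianType ∧
        WAllExclAdditiveFiveLeRankOneSharpNonAbelianType :=
  ⟨fun h ↦ ⟨fun W _ _ p _ hcm h5 hadd _ hr hs hsp htwo htam ↦ h W p hcm h5 hadd hr hs hsp htwo htam,
      fun W _ _ p _ hcm h5 hadd _ hr hs hsp htwo htam ↦ h W p hcm h5 hadd hr hs hsp htwo htam⟩,
    fun ⟨hA, hB⟩ W _ _ p _ hcm h5 hadd hr hs hsp htwo htam ↦ by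
      rcases Additive.sub_exhaustive W p with hM | hG | hT | hW
      · exact hA W p hcm h5 hadd (Or.inl hM) hr hs hsp htwo htam
      · exact hA W p hcm h5 hadd (Or.inr hG) hr hs hsp htwo htam
      · exact hB W p hcm h5 hadd (Or.inl hT) hr hs hsp htwo htam
      · exact hB W p hcm h5 hadd (Or.inr hW) hr hs hsp htwo htam⟩

/-- ♯ from its two type atoms. [folklore] -/
theorem wAllExclAdditiveFiveLeRankOneSharp_of_types
    (hA : WAllExclAdditiveFiveLeRankOneSharpAbelianType)
    (hB : WAllExclAdditiveFiveLeRankOneSharpNonAbelianType) : WAllExclAdditiveFiveLeRankOneSharp :=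
  wAllExclAdditiveFiveLeRankOneSharp_iff_types.2 ⟨hA, hB⟩

/-- All four slices follow from the rank-one slice at `p ≥ 5` (each is an instance). [folklore] -/
theorem sharpAtoms_of_wAllExclAdditiveFiveLeRankOne (h : WAllExclAdditiveFiveLeRankOne) :
    WAllExclAdditiveFiveLeRankOneSharp ∧ WAllExclAdditiveFiveLeRankOneOffSharp ∧
      WAllExclAdditiveFiveLeRankOneSharpAbelianType ∧
        WAllExclAdditiveFiveLeRankOneSharpNonAbelianType :=
  have h2 := sharpSlices_of_wAllExclAdditiveFiveLeRankOne h
  ⟨h2.1, h2.2, (wAllExclAdditiveFiveLeRankOneSharp_iff_types.1 h2.1).1,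
    (wAllExclAdditiveFiveLeRankOneSharp_iff_types.1 h2.1).2⟩

/-- … and from `WAll`. [folklore] -/
theorem sharpAtoms_of_wAll (h : WAll) :
    WAllExclAdditiveFiveLeRankOneSharp ∧ WAllExclAdditiveFiveLeRankOneOffSharp ∧
      WAllExclAdditiveFiveLeRankOneSharpAbelianType ∧
        WAllExclAdditiveFiveLeRankOneSharpNonAbelianType :=
  sharpAtoms_of_wAllExclAdditiveFiveLeRankOne (primeSlices_of_wAll h).1.2.2.2.2.2

/-! ### §3. Registry keys (row 2 read through the ♯ slices; no mathematics) -/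

/-- **Row 2 at `p ≥ 5` (`WAllExclAdditiveFiveLe`) ⇐ its rank-`0` slice ∧ ♯ ∧ off-♯.** [folklore] -/
theorem wAllExclAdditiveFiveLe_of_rankZero_of_sharp_of_offSharp (h0 : WAllExclAdditiveFiveLeRankZero)
    (hS : WAllExclAdditiveFiveLeRankOneSharp) (hO : WAllExclAdditiveFiveLeRankOneOffSharp) :
    WAllExclAdditiveFiveLe :=
  wAllExclAdditiveFiveLe_iff_ranks.2 ⟨h0, wAllExclAdditiveFiveLeRankOne_of_sharp_of_offSharp hS hO⟩

/-- **Row 2 (`WAllExclAdditive`, the route's closes-target) ⇐ the slice at `3` ∧ the rank-`0` slice at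
`p ≥ 5` ∧ ♯ ∧ off-♯** — the route's assembly with its residual items 20135 / 20133 / 20134 read as the
registered leaves `WAllExclAdditiveAtThree` / `WAllExclAdditiveFiveLeRankZero` /
`WAllExclAdditiveFiveLeRankOneOffSharp` and its kernel's conclusion as `WAllExclAdditiveFiveLeRankOneSharp`.
[folklore] -/
theorem wAllExclAdditive_of_atThree_of_fiveLeRankZero_of_sharp_of_offSharp
    (h3 : WAllExclAdditiveAtThree) (h0 : WAllExclAdditiveFiveLeRankZero)
    (hS : WAllExclAdditiveFiveLeRankOneSharp) (hO : WAllExclAdditiveFiveLeRankOneOffSharp) :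
    WAllExclAdditive :=
  wAllExclAdditive_iff_three_fiveLe.2
    ⟨h3, wAllExclAdditiveFiveLe_of_rankZero_of_sharp_of_offSharp h0 hS hO⟩

/-- The same with ♯ read through its two type atoms. [folklore] -/
theorem wAllExclAdditive_of_atThree_of_fiveLeRankZero_of_sharpTypes_of_offSharp
    (h3 : WAllExclAdditiveAtThree) (h0 : WAllExclAdditiveFiveLeRankZero)
    (hA : WAllExclAdditiveFiveLeRankOneSharpAbelianType)
    (hB : WAllExclAdditiveFiveLeRankOneSharpNonAbelianType)
    (hO : WAllExclAdditiveFiveLeRankOneOffSharp) : WAllExclAdditive :=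
  wAllExclAdditive_of_atThree_of_fiveLeRankZero_of_sharp_of_offSharp h3 h0
    (wAllExclAdditiveFiveLeRankOneSharp_of_types hA hB) hO

/-- Conversely row 2 restricts to the four slices. [folklore] -/
theorem sharpAtoms_of_wAllExclAdditive (h : WAllExclAdditive) :
    WAllExclAdditiveFiveLeRankOneSharp ∧ WAllExclAdditiveFiveLeRankOneOffSharp ∧
      WAllExclAdditiveFiveLeRankOneSharpAbelianType ∧
        WAllExclAdditiveFiveLeRankOneSharpNonAbelianType :=
  sharpAtoms_of_wAllExclAdditiveFiveLeRankOne
    (wAllExclAdditiveFiveLe_iff_ranks.1 (wAllExclAdditive_iff_three_fiveLe.1 h).2).2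

end Summit.BirchSwinnertonDyer

end
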